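import Mathlib
import HarnessLib
import Literature.AlgebraicGeometry.Resolution.AffineBlowupAlgebra
import Literature.AlgebraicGeometry.Resolution.BlowupAlgebraLift
import Summits.ResolutionOfSingularities.ResolutionOfSingularities.Theorems.WildQuotientsWildQuotientResolutionS1aMoveStep

/-!
# S1a — (S1b) the blow-up chart ring `(Rees J)_{(yt)}` along a ring isomorphism, and its rigidity

[OURS · L1 W4.5c · lead-1 g6] — NOT a statement of the manuscript; counted 0; AI-level work, weaker than expert
review. Crux stmt-ResolutionOfSingularities-17941 (`WildQuotients.CyclicQuotientFourfolds`), line `s1a-logminvertex`,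
stub `stub_localGame` (producer frame); A5b design `Cruxes/CyclicQuotientFourfolds/Lines/s1a-logminvertex-A5B-DESIGN.md`
(S1), plan-1 RULING 22:26:15Z. Pure algebra feeding `blowupNodeAtlas_of_pos`:

* `blowupAlgebraMap` / `blowupAlgebraEquiv` — a ring iso `e : R ≃+* S` with `J' = e⁻¹ J` and `e x = y` induces
  `R[J'/x] ≃+* S[J/y]` over `e` (universal property of the affine blow-up algebra, `blowupAlgebra.lift`);
* `awayEquiv` — hence `(Rees_R J')_{(xt)} ≃+* (Rees_S J)_{(yt)}` with `awayEquiv (r/1) = (e r)/1`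
  (`awayEquiv_reesChartBase`), through `reesChartEquiv : (Rees J)_{(yt)} ≃ S[J/y]`;
* `away_ringHom_ext` — RIGIDITY: two ring maps out of `(Rees J)_{(yt)}` that agree on `S` (i.e. after `reesChartBase`)
  are equal as soon as the image of `y` is a non-zero-divisor (`blowupAlgebra.ringHom_ext`);
* `appLE_lift_comm_of_le` — naturality of the lifted action on sections over a stable sub-open `W ≤ π⁻¹ O`.
-/

set_option linter.dupNamespace false

noncomputable section

open CategoryTheory AlgebraicGeometry TopologicalSpace Polynomial
open Literature.AlgebraicGeometry.Resolution Literature.AlgebraicGeometry.RelativeSpec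
open Summit.ResolutionOfSingularities.ResolutionOfSingularities.Theorems.WildQuotientResolution.S1
open Summit.ResolutionOfSingularities.ResolutionOfSingularities.Theorems.WildQuotientResolution.S1.MoveStep

namespace Summit.ResolutionOfSingularities.ResolutionOfSingularities.Theorems.WildQuotientResolution.S1.BlowupCharts

universe u

/-! ## Affine blow-up algebras along a ring isomorphism -/

section AwayTransport

variable {R S : Type u} [CommRing R] [CommRing S] (e : R ≃+* S) {J' : Ideal R} {J : Ideal S}
  (hJ : J' = J.comap (e : R →+* S)) {x : R} {y : S} (hx : x ∈ J') (hy : y ∈ J) (hxy : e x = y)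

include hJ in
/-- `e(J') = J`. -/
theorem map_eq_of_eq_comap : J'.map (e : R →+* S) = J := by
  subst hJ; exact Ideal.map_comap_of_surjective _ e.surjective J

include hJ in
/-- `e⁻¹(J) = J'`. -/
theorem map_symm_eq_of_eq_comap : J.map (e.symm : S →+* R) = J' := by
  subst hJ; exact Ideal.map_symm e

include hxy in
/-- The structure map `R → S → S[J/y]` sends `x` to the non-zero-divisor `y`. -/
theorem comp_apply_mem_nonZeroDivisors :
    ((algebraMap S (blowupAlgebra J y)).comp (e : R →+* S)) x ∈ nonZeroDivisors (blowupAlgebra J y) := by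
  rw [RingHom.comp_apply, RingHom.coe_coe, hxy]
  exact algebraMap_mem_nonZeroDivisors_blowupAlgebra

include hJ hxy hy in
/-- `J' · S[J/y] ⊆ (y)`. -/
theorem map_comp_le_span :
    J'.map ((algebraMap S (blowupAlgebra J y)).comp (e : R →+* S)) ≤
      Ideal.span {((algebraMap S (blowupAlgebra J y)).comp (e : R →+* S)) x} := by
  rw [← Ideal.map_map, map_eq_of_eq_comap e hJ, map_blowupAlgebra_eq_span hy, RingHom.comp_apply,
    RingHom.coe_coe, hxy]

/-- **`R[J'/x] → S[J/y]` over `e`** (universal property of the affine blow-up algebra). [OURS · L1 W4.5c] -/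
def blowupAlgebraMap : blowupAlgebra J' x →+* blowupAlgebra J y :=
  blowupAlgebra.lift J' (comp_apply_mem_nonZeroDivisors e hxy) (map_comp_le_span e hJ hy hxy)

/-- `blowupAlgebraMap (r/1) = (e r)/1`. -/
@[simp] theorem blowupAlgebraMap_algebraMap (r : R) :
    blowupAlgebraMap e hJ hy hxy (algebraMap R (blowupAlgebra J' x) r) = algebraMap S (blowupAlgebra J y) (e r) :=
  blowupAlgebra.lift_algebraMap J' _ _ r

include hxy in
/-- The symmetric datum: `e⁻¹ y = x`. -/
theorem symm_apply_eq : e.symm y = x := by rw [← hxy, e.symm_apply_apply]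

include hJ in
/-- The symmetric datum: `J = (e⁻¹)⁻¹ J'`. -/
theorem eq_comap_symm : J = J'.comap (e.symm : S →+* R) := by
  ext s; simp only [hJ, Ideal.mem_comap, RingHom.coe_coe, RingEquiv.apply_symm_apply]

/-- **`R[J'/x] ≃+* S[J/y]` over `e`.** [OURS · L1 W4.5c] -/
def blowupAlgebraEquiv : blowupAlgebra J' x ≃+* blowupAlgebra J y :=
  RingEquiv.ofRingHom (blowupAlgebraMap e hJ hy hxy)
    (blowupAlgebraMap e.symm (eq_comap_symm e hJ) hx (symm_apply_eq e hxy))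
    (blowupAlgebra.ringHom_ext J (φ := algebraMap S (blowupAlgebra J y)) algebraMap_mem_nonZeroDivisors_blowupAlgebra
      (RingHom.ext fun s => by
        rw [RingHom.comp_apply, RingHom.comp_apply, blowupAlgebraMap_algebraMap, blowupAlgebraMap_algebraMap,
          RingEquiv.apply_symm_apply])
      (RingHom.ext fun _ => rfl))
    (blowupAlgebra.ringHom_ext J' (φ := algebraMap R (blowupAlgebra J' x)) algebraMap_mem_nonZeroDivisors_blowupAlgebra
      (RingHom.ext fun r => by
        rw [RingHom.comp_apply, RingHom.comp_apply, blowupAlgebraMap_algebraMap, blowupAlgebraMap_algebraMap,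
          RingEquiv.symm_apply_apply])
      (RingHom.ext fun _ => rfl))

/-- `blowupAlgebraEquiv (r/1) = (e r)/1`. -/
@[simp] theorem blowupAlgebraEquiv_algebraMap (r : R) :
    blowupAlgebraEquiv e hJ hx hy hxy (algebraMap R (blowupAlgebra J' x) r) =
      algebraMap S (blowupAlgebra J y) (e r) :=
  blowupAlgebraMap_algebraMap e hJ hy hxy r

/-- **`(Rees_R J')_{(xt)} ≃+* (Rees_S J)_{(yt)}` over `e`** (through `reesChartEquiv` on both sides). [OURS · L1 W4.5c] -/
def awayEquiv : HomogeneousLocalization.Away (reesGrading J') (reesT x hx) ≃+*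
    HomogeneousLocalization.Away (reesGrading J) (reesT y hy) :=
  ((reesChartEquiv x hx).trans (blowupAlgebraEquiv e hJ hx hy hxy)).trans (reesChartEquiv y hy).symm

/-- `awayEquiv (r/1) = (e r)/1`. -/
@[simp] theorem awayEquiv_reesChartBase (r : R) :
    awayEquiv e hJ hx hy hxy (reesChartBase x hx r) = reesChartBase y hy (e r) := by
  rw [awayEquiv, RingEquiv.trans_apply, RingEquiv.trans_apply, reesChartEquiv_reesChartBase,
    blowupAlgebraEquiv_algebraMap, RingEquiv.symm_apply_eq, reesChartEquiv_reesChartBase]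

end AwayTransport

/-! ## Rigidity of the chart ring -/

section Rigidity

variable {S : Type u} [CommRing S] {J : Ideal S} (y : S) (hy : y ∈ J) {C : Type u} [CommRing C]

/-- **Rigidity of `(Rees J)_{(yt)}` over `S`**: ring maps out of the chart ring agreeing on `S` coincide, provided
`y` goes to a non-zero-divisor. [OURS · L1 W4.5c] -/
theorem away_ringHom_ext {h₁ h₂ : HomogeneousLocalization.Away (reesGrading J) (reesT y hy) →+* C}
    (hreg : h₁ (reesChartBase y hy y) ∈ nonZeroDivisors C)
    (h : ∀ s : S, h₁ (reesChartBase y hy s) = h₂ (reesChartBase y hy s)) : h₁ = h₂ := by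
  have key : h₁.comp (reesChartEquiv y hy).symm.toRingHom = h₂.comp (reesChartEquiv y hy).symm.toRingHom := by
    have hb : ∀ s : S, (reesChartEquiv y hy).symm (algebraMap S (blowupAlgebra J y) s) = reesChartBase y hy s :=
      fun s => by rw [RingEquiv.symm_apply_eq, reesChartEquiv_reesChartBase]
    refine blowupAlgebra.ringHom_ext J (φ := h₁.comp (reesChartBase y hy)) hreg ?_ ?_
    · exact RingHom.ext fun s => by
        rw [RingHom.comp_apply, RingHom.comp_apply, RingEquiv.toRingHom_eq_coe, RingHom.coe_coe, hb]; rfl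
    · exact RingHom.ext fun s => by
        rw [RingHom.comp_apply, RingHom.comp_apply, RingEquiv.toRingHom_eq_coe, RingHom.coe_coe, hb,
          RingHom.comp_apply, h]
  refine RingHom.ext fun z => ?_
  have := RingHom.congr_fun key (reesChartEquiv y hy z)
  simpa using this

end Rigidity

/-! ## Naturality of the lifted action over a stable sub-open -/

section Naturality

variable {V' V Y : Scheme.{u}} {π : V' ⟶ V} {q : V ⟶ Y} {I : V.IdealSheafData} {G : Type u} [Group G]
  (ρ : ActionOver q G) (hπ : IsBlowup π I) (hρ : ∀ g : G, I.comap (ρ.aut g).hom = I)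

/-- **Naturality on sections over `W ≤ π⁻¹ O`**: for a `G`-stable `O ⊆ V` and a stable `W ⊆ π⁻¹ O`, the lifted
automorphism on `Γ(V', W)` and the original one on `Γ(V, O)` commute with `π.appLE O W`. -/
theorem appLE_lift_comm_of_le (O : V.Opens) (hO : ∀ g : G, (ρ.aut g).hom ⁻¹ᵁ O = O) (W : V'.Opens)
    (hW : ∀ g : G, ((liftActionOver ρ hπ hρ).aut g).hom ⁻¹ᵁ W = W) (hle : W ≤ π ⁻¹ᵁ O) (g : G) (s : Γ(V, O)) :
    ((liftActionOver ρ hπ hρ).aut g).hom.appLE W W (hW g).ge (π.appLE O W hle s) =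
      π.appLE O W hle ((ρ.aut g).hom.appLE O O (hO g).ge s) := by
  have key : ∀ (φ ψ : V' ⟶ V) (h : φ = ψ) (e₁ : W ≤ φ ⁻¹ᵁ O) (e₂ : W ≤ ψ ⁻¹ᵁ O),
      φ.appLE O W e₁ = ψ.appLE O W e₂ := by
    intro φ ψ h e₁ e₂; subst h; rfl
  change (π.appLE O W hle ≫ ((liftActionOver ρ hπ hρ).aut g).hom.appLE W W _) s =
    ((ρ.aut g).hom.appLE O O (hO g).ge ≫ π.appLE O W hle) s
  rw [Scheme.Hom.appLE_comp_appLE, Scheme.Hom.appLE_comp_appLE]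
  exact congrArg (fun φ : Γ(V, O) ⟶ Γ(V', W) => φ s) (key _ _ (liftActionOver_aut_hom_comp ρ hπ hρ g) _ _)

end Naturality

end Summit.ResolutionOfSingularities.ResolutionOfSingularities.Theorems.WildQuotientResolution.S1.BlowupCharts

end
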